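import Mathlib
import Summits.Parity.BatemanHorn.Theses.IsogenyRedei
import Summits.Parity.BatemanHorn.Theorems.IsogenyRedeiSplitBlockJacobiSplitMassBound
import Summits.Parity.BatemanHorn.Theorems.IsogenyRedeiSplitBlockJacobiDigitReparametrisation
import HarnessLib

/-!
# Crux `SplitBlockJacobi` (stmt-Parity-11583, route `IsogenyRedei`), line `split-mass-middle-prime`:
# the transfer (the line's PROVED glue)

The crux is `∀ θ ∈ (1/2, 1), J_θ(x) = o(x)` with
`J_θ(x) := Σ_{1 ≤ t ≤ x} Σ_{Q < Q′ prime factors of t²+1, Q > x^θ} (Q | Q′)`.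

Write `N_θ(x)` for the number of triples `(t, Q, Q′)` in the support (the split MASS) and, for
`θ < θ′`, `M_{θ,θ′}(x)` for the MIDDLE-PRIME sum: the same sum restricted to `x^θ < Q ≤ x^{θ′}`.
Two elementary facts:

* `|J_θ(x)| ≤ N_θ(x)` (`norm_pairSumLit_le_card`: every Jacobi symbol is `0, ±1`);
* `J_θ(x) = M_{θ,θ′}(x) + J_{θ′}(x)` for `θ ≤ θ′`, `x ≥ 1` (`pairSumLit_eq_middle_add`: the filter
  `x^θ < Q` splits at `Q ≤ x^{θ′}`, and `x^θ ≤ x^{θ′}`).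

With the LANDED split-mass bound `stub_splitMassBound`
(`N_{θ′}(x) ≤ C (1 − θ′)/(2θ′ − 1) · x` eventually, one absolute `C`), the transfer
`splitBlockJacobi_of_splitMassBound_of_middle` follows: given `θ` and `c > 0` choose
`θ′ := max (max ((θ+1)/2) (3/4)) (1 − c/(4C)) ∈ (θ, 1)`; then eventually
`|J_θ| ≤ |M_{θ,θ′}| + N_{θ′} ≤ (c/2) x + C (1 − θ′)/(2θ′ − 1) x ≤ (c/2) x + 2C(1 − θ′) x ≤ c x`.

Consequences banked here (registered names of the line):
* `splitBlockJacobi_of_middlePrimeJacobi` : middle-prime cancellation for all `1/2 < θ < θ′ < 1`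
  implies the crux;
* `splitBlockJacobi_of_factoredMiddleCancels` : by the LANDED dictionary
  `stub_digitReparametrisation`, so does cancellation of the FACTORED middle sum
  (in `(Q, ν, s)`-currency, `t = ν + Q s`).

All statements are over the literal sums (no definitions), so that the skeleton of the line can
import this file next to its own readable vocabulary.
-/

noncomputable section

open Filter Finset Asymptotics
open scoped Classical

namespace Summit.Parity.BatemanHorn.Cruxes.SplitBlockJacobi.SplitMassMiddlePrime

/-! ### Two elementary facts about the literal sums -/

/-- A Jacobi symbol, cast to `ℝ`, has norm at most `1` (it is `0`, `1` or `−1`). -/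
theorem norm_jacobiSym_intCast_real_le_one (a : ℤ) (b : ℕ) :
    ‖((jacobiSym a b : ℤ) : ℝ)‖ ≤ 1 := by
  rcases jacobiSym.trichotomy a b with h | h | h <;> simp [h]

/-- `|J_θ(x)| ≤ N_θ(x)`: the crux sum is bounded by its trivial mass (literal form). -/
theorem norm_pairSumLit_le_card (θ : ℝ) (x : ℕ) :
    ‖∑ t ∈ Finset.Icc 1 x,
        ∑ q ∈ ((t ^ 2 + 1).primeFactors ×ˢ (t ^ 2 + 1).primeFactors).filter
          (fun q : ℕ × ℕ => (x : ℝ) ^ θ < (q.1 : ℝ) ∧ q.1 < q.2), (jacobiSym (q.1 : ℤ) q.2 : ℝ)‖ ≤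
      ((∑ t ∈ Finset.Icc 1 x, (((t ^ 2 + 1).primeFactors ×ˢ (t ^ 2 + 1).primeFactors).filter
          (fun q : ℕ × ℕ => (x : ℝ) ^ θ < (q.1 : ℝ) ∧ q.1 < q.2)).card : ℕ) : ℝ) := by
  rw [Nat.cast_sum]
  refine (norm_sum_le _ _).trans (Finset.sum_le_sum fun t _ => ?_)
  refine (norm_sum_le _ _).trans ?_
  refine (Finset.sum_le_sum fun q _ => norm_jacobiSym_intCast_real_le_one (q.1 : ℤ) q.2).trans ?_
  rw [Finset.sum_const, nsmul_eq_mul, mul_one]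

/-- `J_θ(x) = M_{θ,θ′}(x) + J_{θ′}(x)` for `θ ≤ θ′` and `x ≥ 1` (literal form): the pair filter
`x^θ < Q ∧ Q < Q′` splits at `Q ≤ x^{θ′}`, and `x^θ ≤ x^{θ′}` because `1 ≤ x`. This is the
"`J_θ − J_{θ′}` is LITERALLY the middle sum" half of the transfer. -/
theorem pairSumLit_eq_middle_add (θ θ' : ℝ) (x : ℕ) (hx : 1 ≤ x) (hθθ' : θ ≤ θ') :
    (∑ t ∈ Finset.Icc 1 x,
        ∑ q ∈ ((t ^ 2 + 1).primeFactors ×ˢ (t ^ 2 + 1).primeFactors).filter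
          (fun q : ℕ × ℕ => (x : ℝ) ^ θ < (q.1 : ℝ) ∧ q.1 < q.2), (jacobiSym (q.1 : ℤ) q.2 : ℝ)) =
      (∑ t ∈ Finset.Icc 1 x,
          ∑ q ∈ ((t ^ 2 + 1).primeFactors ×ˢ (t ^ 2 + 1).primeFactors).filter
            (fun q : ℕ × ℕ => (x : ℝ) ^ θ < (q.1 : ℝ) ∧ (q.1 : ℝ) ≤ (x : ℝ) ^ θ' ∧ q.1 < q.2),
            (jacobiSym (q.1 : ℤ) q.2 : ℝ)) +
        ∑ t ∈ Finset.Icc 1 x,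
          ∑ q ∈ ((t ^ 2 + 1).primeFactors ×ˢ (t ^ 2 + 1).primeFactors).filter
            (fun q : ℕ × ℕ => (x : ℝ) ^ θ' < (q.1 : ℝ) ∧ q.1 < q.2),
            (jacobiSym (q.1 : ℤ) q.2 : ℝ) := by
  have hpow : (x : ℝ) ^ θ ≤ (x : ℝ) ^ θ' :=
    Real.rpow_le_rpow_of_exponent_le (by exact_mod_cast hx) hθθ'
  rw [← Finset.sum_add_distrib]
  refine Finset.sum_congr rfl fun t _ => ?_
  rw [Finset.sum_filter, Finset.sum_filter, Finset.sum_filter, ← Finset.sum_add_distrib]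
  refine Finset.sum_congr rfl fun q _ => ?_
  by_cases hR : (q.1 : ℝ) ≤ (x : ℝ) ^ θ'
  · have hnot : ¬ ((x : ℝ) ^ θ' < (q.1 : ℝ) ∧ q.1 < q.2) := fun h => (not_lt.mpr hR) h.1
    rw [if_neg hnot, add_zero]
    by_cases hP : (x : ℝ) ^ θ < (q.1 : ℝ) ∧ q.1 < q.2
    · rw [if_pos hP, if_pos ⟨hP.1, hR, hP.2⟩]
    · rw [if_neg hP, if_neg (fun h => hP ⟨h.1, h.2.2⟩)]
  · have hnot : ¬ ((x : ℝ) ^ θ < (q.1 : ℝ) ∧ (q.1 : ℝ) ≤ (x : ℝ) ^ θ' ∧ q.1 < q.2) :=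
      fun h => hR h.2.1
    rw [if_neg hnot, zero_add]
    have hlt : (x : ℝ) ^ θ' < (q.1 : ℝ) := not_le.mp hR
    by_cases hB : q.1 < q.2
    · rw [if_pos ⟨hpow.trans_lt hlt, hB⟩, if_pos ⟨hlt, hB⟩]
    · rw [if_neg (fun h => hB h.2), if_neg (fun h => hB h.2)]

/-! ### The transfer -/

/-- **The transfer** (line `split-mass-middle-prime`): a split-mass bound
`N_θ(x) ≤ C (1 − θ)/(2θ − 1) x` (eventually, one `C`, all `θ ∈ (1/2, 1)`) together with middle-prime
cancellation `M_{θ,θ′}(x) = o(x)` (all `1/2 < θ < θ′ < 1`) implies the crux `SplitBlockJacobi`.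
Given `θ` and `c > 0` choose `θ′ := max (max ((θ+1)/2) (3/4)) (1 − c/(4C)) ∈ (θ, 1)`; then eventually
`|J_θ| ≤ |M_{θ,θ′}| + N_{θ′} ≤ (c/2) x + C (1 − θ′)/(2θ′ − 1) x ≤ (c/2) x + 2C (1 − θ′) x ≤ c x`. -/
theorem splitBlockJacobi_of_splitMassBound_of_middle
    (hmass : ∃ C : ℝ, 0 < C ∧ ∀ θ : ℝ, 1 / 2 < θ → θ < 1 →
      ∀ᶠ x : ℕ in Filter.atTop,
        ((∑ t ∈ Finset.Icc 1 x, (((t ^ 2 + 1).primeFactors ×ˢ (t ^ 2 + 1).primeFactors).filter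
            (fun q : ℕ × ℕ => (x : ℝ) ^ θ < (q.1 : ℝ) ∧ q.1 < q.2)).card : ℕ) : ℝ)
          ≤ C * ((1 - θ) / (2 * θ - 1)) * x)
    (hmid : ∀ θ θ' : ℝ, 1 / 2 < θ → θ < θ' → θ' < 1 →
      (fun x : ℕ => ∑ t ∈ Finset.Icc 1 x,
          ∑ q ∈ ((t ^ 2 + 1).primeFactors ×ˢ (t ^ 2 + 1).primeFactors).filter
            (fun q : ℕ × ℕ => (x : ℝ) ^ θ < (q.1 : ℝ) ∧ (q.1 : ℝ) ≤ (x : ℝ) ^ θ' ∧ q.1 < q.2),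
            (jacobiSym (q.1 : ℤ) q.2 : ℝ))
        =o[Filter.atTop] fun x : ℕ => (x : ℝ)) :
    Summit.Parity.BatemanHorn.Theses.IsogenyRedei.SplitBlockJacobi := by
  obtain ⟨C, hC, hmassC⟩ := hmass
  unfold Summit.Parity.BatemanHorn.Theses.IsogenyRedei.SplitBlockJacobi
  intro θ hθ hθ1
  rw [Asymptotics.isLittleO_iff]
  intro c hc
  -- the auxiliary exponent θ'
  set θ' : ℝ := max (max ((θ + 1) / 2) (3 / 4)) (1 - c / (4 * C)) with hθ'_def
  have hθθ' : θ < θ' := by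
    have h : θ < (θ + 1) / 2 := by linarith
    exact h.trans_le ((le_max_left _ _).trans (le_max_left _ _))
  have h34 : (3 : ℝ) / 4 ≤ θ' := (le_max_right _ _).trans (le_max_left _ _)
  have hcC : 1 - c / (4 * C) ≤ θ' := le_max_right _ _
  have hθ'1 : θ' < 1 := by
    have h1 : (θ + 1) / 2 < 1 := by linarith
    have h2 : (3 : ℝ) / 4 < 1 := by norm_num
    have h3 : 1 - c / (4 * C) < 1 := by
      have : 0 < c / (4 * C) := by positivity
      linarith
    exact max_lt (max_lt h1 h2) h3
  have hθ'half : 1 / 2 < θ' := by linarith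
  -- constant bookkeeping (before the big sums enter the context): C (1-θ')/(2θ'-1) ≤ c/2
  have hfrac : (1 - θ') / (2 * θ' - 1) ≤ 2 * (1 - θ') := by
    rw [div_le_iff₀ (by linarith)]
    nlinarith [mul_nonneg (sub_nonneg.mpr h34) (sub_nonneg.mpr hθ'1.le)]
  have hconst : C * ((1 - θ') / (2 * θ' - 1)) ≤ c / 2 := by
    have h1 : 1 - θ' ≤ c / (4 * C) := by linarith
    calc C * ((1 - θ') / (2 * θ' - 1)) ≤ C * (2 * (1 - θ')) :=
          mul_le_mul_of_nonneg_left hfrac hC.le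
      _ ≤ C * (2 * (c / (4 * C))) := by gcongr
      _ = c / 2 := by field_simp; ring
  have hfinal : ∀ x : ℕ, c / 2 * (x : ℝ) + C * ((1 - θ') / (2 * θ' - 1)) * x ≤ c * x := by
    intro x
    have hxnn : (0 : ℝ) ≤ x := Nat.cast_nonneg x
    nlinarith [mul_le_mul_of_nonneg_right hconst hxnn]
  -- the two eventual bounds
  have hM := hmid θ θ' hθ hθθ' hθ'1
  rw [Asymptotics.isLittleO_iff] at hM
  have hM' := hM (half_pos hc)
  have hN := hmassC θ' hθ'half hθ'1
  filter_upwards [hM', hN, Filter.eventually_ge_atTop 1] with x hxM hxN hx1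
  have hnorm : ‖(x : ℝ)‖ = x := Real.norm_natCast x
  rw [hnorm] at hxM ⊢
  have hJ' := (norm_pairSumLit_le_card θ' x).trans hxN
  rw [pairSumLit_eq_middle_add θ θ' x hx1 hθθ'.le]
  exact (norm_add_le _ _).trans ((add_le_add hxM hJ').trans (hfinal x))

/-! ### The two registered implications -/

/-- **Registered (line `split-mass-middle-prime`)**: middle-prime cancellation implies the crux.
If for all `1/2 < θ < θ′ < 1` the middle-prime Jacobi sum
`M_{θ,θ′}(x) = Σ_{1 ≤ t ≤ x} Σ_{Q < Q′ prime factors of t²+1, x^θ < Q ≤ x^{θ′}} (Q | Q′)` is `o(x)`, then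
`SplitBlockJacobi` holds — by the transfer and the LANDED split-mass bound `stub_splitMassBound`. -/
theorem splitBlockJacobi_of_middlePrimeJacobi :
    (∀ θ θ' : ℝ, 1 / 2 < θ → θ < θ' → θ' < 1 →
      (fun x : ℕ => ∑ t ∈ Finset.Icc 1 x,
          ∑ q ∈ ((t ^ 2 + 1).primeFactors ×ˢ (t ^ 2 + 1).primeFactors).filter
            (fun q : ℕ × ℕ => (x : ℝ) ^ θ < (q.1 : ℝ) ∧ (q.1 : ℝ) ≤ (x : ℝ) ^ θ' ∧ q.1 < q.2),
            (jacobiSym (q.1 : ℤ) q.2 : ℝ))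
        =o[Filter.atTop] fun x : ℕ => (x : ℝ)) →
    Summit.Parity.BatemanHorn.Theses.IsogenyRedei.SplitBlockJacobi :=
  fun hmid => splitBlockJacobi_of_splitMassBound_of_middle stub_splitMassBound hmid

/-- **Registered (line `split-mass-middle-prime`)**: factored middle cancellation implies the crux.
If for all `1/2 < θ < θ′ < 1` the FACTORED middle sum
`Σ_{x^θ < Q ≤ x^{θ′} prime} Σ_{ν mod Q, ν² ≡ −1} Σ_{s : ν + Qs ≤ x} (c_ν + 2νs | Q) · Σ_{Q′ ∣ R, Q′ > Q prime} (R/Q′ | Q)`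
(`R = ((ν+Qs)²+1)/Q`, `c_ν = (ν²+1)/Q`) is `o(x)`, then `SplitBlockJacobi` holds — by the LANDED
dictionary `stub_digitReparametrisation` and `splitBlockJacobi_of_middlePrimeJacobi`. -/
theorem splitBlockJacobi_of_factoredMiddleCancels :
    (∀ θ θ' : ℝ, 1 / 2 < θ → θ < θ' → θ' < 1 →
      (fun x : ℕ =>
        ∑ Q ∈ (Finset.range (x + 1)).filter
            (fun Q : ℕ => Q.Prime ∧ (x : ℝ) ^ θ < (Q : ℝ) ∧ (Q : ℝ) ≤ (x : ℝ) ^ θ'),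
          ∑ ν ∈ (Finset.range Q).filter (fun ν : ℕ => Q ∣ ν ^ 2 + 1),
            ∑ s ∈ (Finset.range (x + 1)).filter (fun s : ℕ => ν + Q * s ≤ x),
              (jacobiSym (((ν ^ 2 + 1) / Q + 2 * ν * s : ℕ) : ℤ) Q : ℝ) *
                ∑ Q' ∈ ((((ν + Q * s) ^ 2 + 1) / Q).primeFactors).filter (fun Q' : ℕ => Q < Q'),
                  (jacobiSym ((((ν + Q * s) ^ 2 + 1) / Q / Q' : ℕ) : ℤ) Q : ℝ))
        =o[Filter.atTop] fun x : ℕ => (x : ℝ)) →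
    Summit.Parity.BatemanHorn.Theses.IsogenyRedei.SplitBlockJacobi :=
  fun hfac => splitBlockJacobi_of_middlePrimeJacobi (stub_digitReparametrisation hfac)

end Summit.Parity.BatemanHorn.Cruxes.SplitBlockJacobi.SplitMassMiddlePrime

end
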